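import Mathlib
import Literature.MathematicalPhysics.StatisticalMechanics.LennardJonesClusters

/-!
# Localisation of a.e. Good sites (stub `stub_localisation` of `GapTwelveToBarlow`)

Counting glue used by the line `Sketch` for the crux `GapTwelveToBarlow`
(item stmt-AtomisticToContinuum-15807, route `SquareWellLayerCake`).

For a configuration `X : Fin N → ℝ³` call the site `i` *Good* when the `11/10`-neighbourhood of
`X i` is `55/57`-separated from everything, exactly twelve other particles lie within distance `1`
of `X i` and at most twelve within `11/10` (the hypothesis predicate of the crux, verbatim), and say
that `i` has an *all-Good `D`-ball* when every site within distance `D` of `X i` is Good.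

`stub_localisation`: along any sequence of configurations whose fraction of non-Good sites tends
to zero, for every radius `D > 0` the fraction of sites without an all-Good `D`-ball tends to zero.

Proof.  A Good site is `55/57`-separated from every other site (clause one at `j = i`).  A site
without an all-Good `D`-ball is either non-Good itself, or a Good site within `D` of some non-Good
site `j`; for fixed `j` these Good sites are pairwise `55/57`-separated points of the ball of
radius `D` about `X j` (in particular `X` is injective on them), hence number at most
`C = (2·D/(55/57) + 1)³` by the packing bound `card_le_of_separated_of_dist_le`.  So
`#(no all-Good D-ball) ≤ (1 + C) · #(non-Good)` for every `N`, and the fractions are squeezed to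
zero (`squeeze_zero`).  The two counting lemmas are stated for an arbitrary site predicate `P`
whose holders are `55/57`-separated from every other site; only this consequence of Good is used.
-/

noncomputable section

namespace Summit.AtomisticToContinuum.Crystallization.Theorems.SquareWellLayerCakeGapTwelveToBarlow

open Literature.MathematicalPhysics.StatisticalMechanics

/-- Fibre count: a set `F` of sites, each `55/57`-separated from every other site and within
distance `D` of the fixed site `j`, has at most `(2·D/(55/57) + 1)³` elements (the configuration
is injective on `F`, and the positions `X '' F` are `55/57`-separated points of the ball of
radius `D` about `X j`, counted by `card_le_of_separated_of_dist_le`). -/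
theorem card_separated_near_le {N : ℕ} (X : Fin N → EuclideanSpace ℝ (Fin 3)) (j : Fin N)
    {D : ℝ} (hD : 0 ≤ D) (F : Finset (Fin N))
    (hF : ∀ i ∈ F,
      (∀ k : Fin N, k ≠ i → (55 : ℝ) / 57 ≤ dist (X i) (X k)) ∧
        dist (X i) (X j) ≤ D) :
    (F.card : ℝ) ≤ (2 * D / (55 / 57) + 1) ^ 3 := by
  have hr : (0 : ℝ) < 55 / 57 := by norm_num
  have hinj : Set.InjOn X F := fun i hi i' _ hii' => by
    by_contra hne
    have h := (hF i hi).1 i' (Ne.symm hne)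
    rw [hii', dist_self] at h
    exact absurd h (not_le.2 hr)
  rw [← Finset.card_image_of_injOn hinj]
  have h := card_le_of_separated_of_dist_le (F.image X) (X j) hr hD ?_ ?_
  · rwa [finrank_euclideanSpace_fin] at h
  · intro c hc
    obtain ⟨i, hi, rfl⟩ := Finset.mem_image.1 hc
    exact (hF i hi).2
  · intro c hc d hd hne
    obtain ⟨i, hi, rfl⟩ := Finset.mem_image.1 hc
    obtain ⟨i', -, rfl⟩ := Finset.mem_image.1 hd
    exact (hF i hi).1 i' fun h => hne (congrArg X h.symm)

/-- Counting: if every site satisfying `P` is `55/57`-separated from every other site, then for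
every `D ≥ 0` the sites having a non-`P` site within distance `D` number at most
`1 + (2·D/(55/57) + 1)³` times the non-`P` sites (such a site is non-`P` itself or lies in the
fibre of `P`-sites within `D` of a non-`P` site; each fibre is small, `card_separated_near_le`). -/
theorem card_not_ball_le {N : ℕ} (X : Fin N → EuclideanSpace ℝ (Fin 3)) {D : ℝ}
    (hD : 0 ≤ D) (P : Fin N → Prop)
    (hP : ∀ i : Fin N, P i → ∀ k : Fin N, k ≠ i → (55 : ℝ) / 57 ≤ dist (X i) (X k)) :
    (Nat.card {i : Fin N // ¬ ∀ j : Fin N, dist (X i) (X j) ≤ D → P j} : ℝ) ≤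
      (1 + (2 * D / (55 / 57) + 1) ^ 3) * Nat.card {i : Fin N // ¬ P i} := by
  classical
  rw [Nat.card_eq_fintype_card, Fintype.card_subtype, Nat.card_eq_fintype_card,
    Fintype.card_subtype]
  set Bad := Finset.univ.filter fun i : Fin N => ¬ P i with hBad
  set BadD := Finset.univ.filter fun i : Fin N => ¬ ∀ j : Fin N, dist (X i) (X j) ≤ D → P j
    with hBadD
  set Fib : Fin N → Finset (Fin N) := fun j =>
    Finset.univ.filter fun i : Fin N => P i ∧ dist (X i) (X j) ≤ D with hFib
  -- a site with a non-`P` site within `D` is non-`P` or a `P`-site near a non-`P` one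
  have hcover : BadD ⊆ Bad ∪ Bad.biUnion Fib := by
    intro i hi
    simp only [hBadD, Finset.mem_filter, Finset.mem_univ, true_and] at hi
    push Not at hi
    obtain ⟨j, hj, hjbad⟩ := hi
    rw [Finset.mem_union, Finset.mem_biUnion]
    by_cases hgi : P i
    · right
      refine ⟨j, ?_, ?_⟩
      · simpa only [hBad, Finset.mem_filter, Finset.mem_univ, true_and] using hjbad
      · simpa only [hFib, Finset.mem_filter, Finset.mem_univ, true_and] using And.intro hgi hj
    · left
      simpa only [hBad, Finset.mem_filter, Finset.mem_univ, true_and] using hgi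
  -- each fibre is small
  have hfib : ∀ j ∈ Bad, ((Fib j).card : ℝ) ≤ (2 * D / (55 / 57) + 1) ^ 3 := fun j _ =>
    card_separated_near_le X j hD (Fib j) fun i hi => by
      simp only [hFib, Finset.mem_filter, Finset.mem_univ, true_and] at hi
      exact ⟨hP i hi.1, hi.2⟩
  have h1 : BadD.card ≤ Bad.card + (Bad.biUnion Fib).card :=
    (Finset.card_le_card hcover).trans (Finset.card_union_le _ _)
  have h1' : (BadD.card : ℝ) ≤ Bad.card + (Bad.biUnion Fib).card := by exact_mod_cast h1
  have h2 : ((Bad.biUnion Fib).card : ℝ) ≤ Bad.card * (2 * D / (55 / 57) + 1) ^ 3 :=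
    calc ((Bad.biUnion Fib).card : ℝ) ≤ ∑ j ∈ Bad, ((Fib j).card : ℝ) := by
          exact_mod_cast Finset.card_biUnion_le
      _ ≤ ∑ j ∈ Bad, (2 * D / (55 / 57) + 1) ^ 3 := Finset.sum_le_sum hfib
      _ = Bad.card * (2 * D / (55 / 57) + 1) ^ 3 := by rw [Finset.sum_const, nsmul_eq_mul]
  calc (BadD.card : ℝ) ≤ Bad.card + (Bad.biUnion Fib).card := h1'
    _ ≤ Bad.card + Bad.card * (2 * D / (55 / 57) + 1) ^ 3 := by linarith
    _ = (1 + (2 * D / (55 / 57) + 1) ^ 3) * Bad.card := by ring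

/-- **Localisation** (`stub_localisation`, glue of the line `Sketch` for the crux
`GapTwelveToBarlow`; counting only, no minimality): along any sequence of configurations with
a.e. Good sites, for every radius `D > 0` a.e. site has an all-Good `D`-ball.  A Good site is
`55/57`-separated from every other site (clause one at `j = i`, `dist_self`), so the count
`card_not_ball_le` applies with `P = Good`, and the limit is `squeeze_zero`. -/
theorem stub_localisation :
    ∀ x : (N : ℕ) → (Fin N → EuclideanSpace ℝ (Fin 3)),
      Filter.Tendsto (fun N : ℕ => (Nat.card {i : Fin N // ¬ (
          (∀ j : Fin N, dist (x N i) (x N j) ≤ 11 / 10 → ∀ k : Fin N, k ≠ j → (55 : ℝ) / 57 ≤ dist (x N j) (x N k)) ∧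
          (Finset.univ.filter fun j : Fin N => j ≠ i ∧ dist (x N i) (x N j) ≤ 1).card = 12 ∧
          (Finset.univ.filter fun j : Fin N => j ≠ i ∧ dist (x N i) (x N j) ≤ 11 / 10).card ≤ 12)} : ℝ) / N)
        Filter.atTop (nhds 0) →
      ∀ D : ℝ, 0 < D →
        Filter.Tendsto (fun N : ℕ => (Nat.card {i : Fin N // ¬ (∀ j : Fin N, dist (x N i) (x N j) ≤ D →
          ((∀ j' : Fin N, dist (x N j) (x N j') ≤ 11 / 10 → ∀ k : Fin N, k ≠ j' → (55 : ℝ) / 57 ≤ dist (x N j') (x N k)) ∧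
          (Finset.univ.filter fun j' : Fin N => j' ≠ j ∧ dist (x N j) (x N j') ≤ 1).card = 12 ∧
          (Finset.univ.filter fun j' : Fin N => j' ≠ j ∧ dist (x N j) (x N j') ≤ 11 / 10).card ≤ 12))} : ℝ) / N)
          Filter.atTop (nhds 0) := by
  intro x hx D hD
  have hC := hx.const_mul (1 + (2 * D / (55 / 57) + 1) ^ 3 : ℝ)
  rw [mul_zero] at hC
  refine squeeze_zero (fun N => by positivity) (fun N => ?_) hC
  rw [mul_div_assoc']
  refine div_le_div_of_nonneg_right (card_not_ball_le (x N) hD.le _ fun i hi => ?_)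
    (Nat.cast_nonneg N)
  exact hi.1 i (by rw [dist_self]; norm_num)

end Summit.AtomisticToContinuum.Crystallization.Theorems.SquareWellLayerCakeGapTwelveToBarlow

end
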